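import Summits.QuantumFields.GaugeBoot.OneOverNSeriesCoeff
import Summits.QuantumFields.GaugeBoot.OneOverNAPriori
import HarnessLib

/-!
# Power series in `β` of the `1/N` coefficients, II: the Catalan bound (gauge-boot, ADDENDUM 31 part B)

HONEST FRAMING (cell `pub-gaugeboot`, page 1 of every file): the venture produces certified bounds
on lattice expectations at stated coupling, gauge group, dimension and torus size; NOT a mass gap,
NOT a continuum limit, NOT a string tension; NOT Yang–Mills-summit-bearing (barriers
`FixedCouplingUltralocality`, `PerturbativeInvisibility`).  Strong-coupling `SO(N)` lattice gauge theory with free boundary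
condition (S. Chatterjee, Comm. Math. Phys. **366** (2019); S. Chatterjee, J. Jafarov, arXiv:1604.04777); nothing about
four-dimensional continuum Yang–Mills or a mass gap.

## Content

Chatterjee–Jafarov's Lemma 7.3 bounds the power-series coefficients `a_{i,k}(s)` by
`K^{(5+k)i+ι(δ)} |δ|^{2k} C_{δ₁−1}⋯C_{δₙ−1}`.  Here is the lane's version for the symmetrized family of `OneOverNSeriesCoeff`:
`|b_{j,i}(s)| ≤ B_j R_j^i Φ_{K_j}(s)` on genuine loop sequences, with the Catalan weight `Φ_K(s) = K^{ι(s)} Π C_{|lᵣ|−1}` of the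
source's Lemma 10.1 and LEVEL-DEPENDENT constants `K_{j+1} = 64K_j²` (the factor `|s|` of a twisting/merger source and the
exponential loss of a merged Catalan product are absorbed by `|t|·Φ_K(u) ≤ Φ_{64K²}(t)` for `|u| ≤ |t|`, `len_mul_weight_le_weight`,
instead of the printed Lemma (app1) and the factor `|δ|^{2k}`).  One level is `seriesCoeff_level_bound` (induction on the
`β`-degree and on `ι(s)`: splittings cost `2/K ≤ 1/4`, deformations `A_d K⁴/R ≤ 1/4`, the lower levels `5B_{j−1} ≤ 5B_j/12`);
all levels `seriesCoeff_bound`.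

Everything is `[folklore]` given the tree's Catalan bookkeeping (`sum_invIdx_weight_le`, `sum_sameIdx_weight_le`,
`sum_deformIdx_weight_le`, `sum_le_len_mul_weight`).
-/

noncomputable section

open Finset
open Literature.MathematicalPhysics.QuantumFieldTheory.Chatterjee2019LargeN
open Literature.MathematicalPhysics.QuantumFieldTheory.Chatterjee2019LargeN.CoeffCatalanBoundProof

namespace Summit.QuantumFields.GaugeBoot

namespace StringDuality

variable {d : ℕ}

/-! ## One level -/

/-- **One level of the Catalan bound.**  Constants: `K₁ ≥ 1`, `64K₁² ≤ K`, `K ≥ 8`, `0 ≤ R₁ ≤ R`, `1 ≤ R`,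
`A_d K⁴ ≤ R/4` (`A_d = 2·2(d−1)·256`), `0 ≤ B₁`, `12B₁ ≤ B`, `1 ≤ B`.  If the two lower levels satisfy
`|P_i(t)|, |Q_i(t)| ≤ B₁ R₁^i Φ_{K₁}(t)` on genuine loop sequences and the level `c` has `|c_i(∅)| ≤ 1` and the symmetrized
coefficient recursion with sources `P, Q`, then `|c_i(t)| ≤ B Rⁱ Φ_K(t)` on genuine loop sequences.
[cite: ChatterjeeJafarov2016OneOverN, Lemma 7.3 (and its proof: (dd0)–(dd4)); Chatterjee2019LargeN, Lemma 10.1] -/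
theorem seriesCoeff_level_bound {K K₁ R R₁ B B₁ : ℝ} (hK₁ : 1 ≤ K₁) (hKK : 64 * K₁ ^ 2 ≤ K) (hK8 : 8 ≤ K)
    (hR₁ : 0 ≤ R₁) (hRR : R₁ ≤ R) (hR1 : 1 ≤ R)
    (hAR : 2 * ((2 * (d - 1) : ℕ) : ℝ) * 256 * K ^ 4 ≤ R / 4) (hB₁ : 0 ≤ B₁) (hBB : 12 * B₁ ≤ B) (hB1 : 1 ≤ B)
    (c P Q : ℕ → LoopSeq d → ℝ)
    (hP : ∀ (i : ℕ) (t : LoopSeq d), IsLoopSeq t → |P i t| ≤ B₁ * R₁ ^ i * (K₁ ^ t.index * catProd t))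
    (hQ : ∀ (i : ℕ) (t : LoopSeq d), IsLoopSeq t → |Q i t| ≤ B₁ * R₁ ^ i * (K₁ ^ t.index * catProd t))
    (hnil : ∀ i, |c i []| ≤ 1)
    (hrec0 : ∀ s : LoopSeq d, s ≠ [] → (∀ l ∈ s, l ≠ []) →
      (s.len : ℝ) * c 0 s - ((∑ o : InvIdx s, c 0 (s.negSplitAt o)) - (∑ o : SameIdx s, c 0 (s.posSplitAt o))) =
        (s.len : ℝ) * P 0 s
          + ((∑ o : SameIdx s, P 0 (s.negTwistAt o)) - ∑ o : InvIdx s, P 0 (s.posTwistAt o))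
          + ((∑ o : MergeIdx s, Q 0 (s.negMergeAt o)) - ∑ o : MergeIdx s, Q 0 (s.posMergeAt o)))
    (hrecS : ∀ (i : ℕ) (s : LoopSeq d), s ≠ [] → (∀ l ∈ s, l ≠ []) →
      (s.len : ℝ) * c (i + 1) s -
          ((∑ o : InvIdx s, c (i + 1) (s.negSplitAt o)) - (∑ o : SameIdx s, c (i + 1) (s.posSplitAt o))
            + (∑ o : DeformIdx s, c i (s.negDeformAt o)) - (∑ o : DeformIdx s, c i (s.posDeformAt o))) =
        (s.len : ℝ) * P (i + 1) s
          + ((∑ o : SameIdx s, P (i + 1) (s.negTwistAt o)) - ∑ o : InvIdx s, P (i + 1) (s.posTwistAt o))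
          + ((∑ o : MergeIdx s, Q (i + 1) (s.negMergeAt o)) - ∑ o : MergeIdx s, Q (i + 1) (s.posMergeAt o))) :
    ∀ (i : ℕ) (t : LoopSeq d), IsLoopSeq t → |c i t| ≤ B * R ^ i * (K ^ t.index * catProd t) := by
  have hK1 : 1 ≤ K := by nlinarith
  have hK0 : 0 ≤ K := by linarith
  have hK₁0 : 0 ≤ K₁ := by linarith
  have hK₁K : K₁ ≤ K := by nlinarith
  have hR0 : 0 ≤ R := by linarith
  have hB0 : 0 ≤ B := by linarith
  have hc₁ : (0 : ℝ) ≤ ((2 * (d - 1) : ℕ) : ℝ) := Nat.cast_nonneg _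
  -- ### the inner claim: one `β`-degree `i`, with deformation input `Din` bounded by `E Φ_K`
  have inner : ∀ (i : ℕ) (Din : LoopSeq d → ℝ) (E : ℝ), 0 ≤ E →
      (∀ t : LoopSeq d, IsLoopSeq t → |Din t| ≤ E * (K ^ t.index * catProd t)) →
      2 * ((2 * (d - 1) : ℕ) : ℝ) * 256 * K ^ 4 * E ≤ B * R ^ i / 4 →
      (∀ s : LoopSeq d, s ≠ [] → (∀ l ∈ s, l ≠ []) →
        (s.len : ℝ) * c i s -
            ((∑ o : InvIdx s, c i (s.negSplitAt o)) - (∑ o : SameIdx s, c i (s.posSplitAt o))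
              + (∑ o : DeformIdx s, Din (s.negDeformAt o)) - (∑ o : DeformIdx s, Din (s.posDeformAt o))) =
          (s.len : ℝ) * P i s
            + ((∑ o : SameIdx s, P i (s.negTwistAt o)) - ∑ o : InvIdx s, P i (s.posTwistAt o))
            + ((∑ o : MergeIdx s, Q i (s.negMergeAt o)) - ∑ o : MergeIdx s, Q i (s.posMergeAt o))) →
      ∀ t : LoopSeq d, IsLoopSeq t → |c i t| ≤ B * R ^ i * (K ^ t.index * catProd t) := by
    intro i Din E hE0 hDin hE hrec t ht
    suffices H : ∀ (n : ℕ) (t : LoopSeq d), t.index = n → IsLoopSeq t →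
        |c i t| ≤ B * R ^ i * (K ^ t.index * catProd t) from H _ t rfl ht
    intro n
    induction n using Nat.strong_induction_on with
    | _ n ihn =>
    intro t htn ht
    have hRi : 1 ≤ R ^ i := one_le_pow₀ hR1
    by_cases hne : t = []
    · subst hne
      rw [LoopSeq.index_nil, pow_zero, one_mul]
      have h1 : catProd ([] : LoopSeq d) = 1 := rfl
      rw [h1, mul_one]
      calc |c i []| ≤ 1 := hnil i
        _ ≤ B * R ^ i := by nlinarith
    have hgood : ∀ l ∈ t, l ≠ [] := fun l hl => (ht l hl).2
    have hL : (0 : ℝ) < t.len := by exact_mod_cast len_pos_of_components_ne_nil hne hgood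
    have hι : 1 ≤ t.index := one_le_index ht hne
    -- the weights
    set Φ : ℝ := K ^ t.index * catProd t with hΦ
    set X : ℝ := K ^ (t.index - 1) * catProd t with hX
    have hX0 : 0 ≤ X := mul_nonneg (pow_nonneg hK0 _) (catProd_nonneg t)
    have hKX : K * X = Φ := by
      rw [hX, hΦ, ← mul_assoc, ← pow_succ', Nat.sub_add_cancel hι]
    have hΦ0 : 0 ≤ Φ := mul_nonneg (pow_nonneg hK0 _) (catProd_nonneg t)
    have hpow4 : K ^ (t.index + 4) * catProd t = K ^ 4 * Φ := by rw [hΦ, pow_add]; ring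
    -- (a) splittings, by the induction hypothesis on the index
    have hS1 : |∑ o : InvIdx t, c i (t.negSplitAt o)| ≤ B * R ^ i * ((t.len : ℝ) * X) := by
      calc |∑ o : InvIdx t, c i (t.negSplitAt o)| ≤ ∑ o : InvIdx t, |c i (t.negSplitAt o)| :=
            Finset.abs_sum_le_sum_abs _ _
        _ ≤ ∑ o : InvIdx t, B * R ^ i * (K ^ (t.negSplitAt o).index * catProd (t.negSplitAt o)) :=
            Finset.sum_le_sum fun o _ =>
              ihn _ (htn ▸ LoopSeq.index_negSplitAt_lt hgood o) _ rfl (ht.negSplitAt o)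
        _ = B * R ^ i * ∑ o : InvIdx t, K ^ (t.negSplitAt o).index * catProd (t.negSplitAt o) := by
            rw [← Finset.mul_sum]
        _ ≤ B * R ^ i * ((t.len : ℝ) * X) :=
            mul_le_mul_of_nonneg_left (sum_invIdx_weight_le hK1 ht) (by positivity)
    have hS2 : |∑ o : SameIdx t, c i (t.posSplitAt o)| ≤ B * R ^ i * ((t.len : ℝ) * X) := by
      calc |∑ o : SameIdx t, c i (t.posSplitAt o)| ≤ ∑ o : SameIdx t, |c i (t.posSplitAt o)| :=
            Finset.abs_sum_le_sum_abs _ _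
        _ ≤ ∑ o : SameIdx t, B * R ^ i * (K ^ (t.posSplitAt o).index * catProd (t.posSplitAt o)) :=
            Finset.sum_le_sum fun o _ =>
              ihn _ (htn ▸ LoopSeq.index_posSplitAt_lt hgood o) _ rfl (ht.posSplitAt o)
        _ = B * R ^ i * ∑ o : SameIdx t, K ^ (t.posSplitAt o).index * catProd (t.posSplitAt o) := by
            rw [← Finset.mul_sum]
        _ ≤ B * R ^ i * ((t.len : ℝ) * X) :=
            mul_le_mul_of_nonneg_left (sum_sameIdx_weight_le hK1 ht) (by positivity)
    -- (b) deformations, by the bound on the input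
    have hD1 : |∑ o : DeformIdx t, Din (t.negDeformAt o)| ≤
        E * ((t.len : ℝ) * (((2 * (d - 1) : ℕ) : ℝ) * (256 * (K ^ 4 * Φ)))) := by
      calc |∑ o : DeformIdx t, Din (t.negDeformAt o)| ≤ ∑ o : DeformIdx t, |Din (t.negDeformAt o)| :=
            Finset.abs_sum_le_sum_abs _ _
        _ ≤ ∑ o : DeformIdx t, E * (K ^ (t.negDeformAt o).index * catProd (t.negDeformAt o)) :=
            Finset.sum_le_sum fun o _ => hDin _ (ht.negDeformAt o)
        _ = E * ∑ o : DeformIdx t, K ^ (t.negDeformAt o).index * catProd (t.negDeformAt o) := by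
            rw [← Finset.mul_sum]
        _ ≤ E * ((t.len : ℝ) * (((2 * (d - 1) : ℕ) : ℝ) * (256 * (K ^ (t.index + 4) * catProd t)))) :=
            mul_le_mul_of_nonneg_left (sum_deformIdx_weight_le hK1 ht (fun o => t.negDeformAt o)
              (fun o => ⟨_, Word.length_negDeform_le (t.get o.1) o.2.1 o.2.2.1, rfl⟩)) hE0
        _ = E * ((t.len : ℝ) * (((2 * (d - 1) : ℕ) : ℝ) * (256 * (K ^ 4 * Φ)))) := by rw [hpow4]
    have hD2 : |∑ o : DeformIdx t, Din (t.posDeformAt o)| ≤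
        E * ((t.len : ℝ) * (((2 * (d - 1) : ℕ) : ℝ) * (256 * (K ^ 4 * Φ)))) := by
      calc |∑ o : DeformIdx t, Din (t.posDeformAt o)| ≤ ∑ o : DeformIdx t, |Din (t.posDeformAt o)| :=
            Finset.abs_sum_le_sum_abs _ _
        _ ≤ ∑ o : DeformIdx t, E * (K ^ (t.posDeformAt o).index * catProd (t.posDeformAt o)) :=
            Finset.sum_le_sum fun o _ => hDin _ (ht.posDeformAt o)
        _ = E * ∑ o : DeformIdx t, K ^ (t.posDeformAt o).index * catProd (t.posDeformAt o) := by
            rw [← Finset.mul_sum]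
        _ ≤ E * ((t.len : ℝ) * (((2 * (d - 1) : ℕ) : ℝ) * (256 * (K ^ (t.index + 4) * catProd t)))) :=
            mul_le_mul_of_nonneg_left (sum_deformIdx_weight_le hK1 ht (fun o => t.posDeformAt o)
              (fun o => ⟨_, Word.length_posDeform_le (t.get o.1) o.2.1 o.2.2.1, rfl⟩)) hE0
        _ = E * ((t.len : ℝ) * (((2 * (d - 1) : ℕ) : ℝ) * (256 * (K ^ 4 * Φ)))) := by rw [hpow4]
    -- (c) the lower levels: the value, the twistings, the mergers
    have hBR₁ : 0 ≤ B₁ * R₁ ^ i := mul_nonneg hB₁ (pow_nonneg hR₁ _)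
    have hlow : B₁ * R₁ ^ i * Φ ≤ B₁ * R ^ i * Φ :=
      mul_le_mul_of_nonneg_right (mul_le_mul_of_nonneg_left (pow_le_pow_left₀ hR₁ hRR i) hB₁) hΦ0
    have hPt : |(t.len : ℝ) * P i t| ≤ (t.len : ℝ) * (B₁ * R ^ i * Φ) := by
      rw [abs_mul, abs_of_nonneg hL.le]
      refine mul_le_mul_of_nonneg_left ((hP i t ht).trans ?_) hL.le
      exact (mul_le_mul_of_nonneg_left (weight_mono hK₁0 hK₁K t) hBR₁).trans hlow
    have hT1 : |∑ o : SameIdx t, P i (t.negTwistAt o)| ≤ (t.len : ℝ) * (B₁ * R ^ i * Φ) :=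
      (sum_le_len_mul_weight hK₁ hKK hBR₁ ht (card_sameIdx_le t) _ (fun o => t.negTwistAt o)
        (fun o => len_negTwistAt_le t o) (fun o => hP i _ (ht.negTwistAt o))).trans
        (mul_le_mul_of_nonneg_left hlow hL.le)
    have hT2 : |∑ o : InvIdx t, P i (t.posTwistAt o)| ≤ (t.len : ℝ) * (B₁ * R ^ i * Φ) :=
      (sum_le_len_mul_weight hK₁ hKK hBR₁ ht (card_invIdx_le t) _ (fun o => t.posTwistAt o)
        (fun o => len_posTwistAt_le t o) (fun o => hP i _ (ht.posTwistAt o))).trans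
        (mul_le_mul_of_nonneg_left hlow hL.le)
    have hM1 : |∑ o : MergeIdx t, Q i (t.negMergeAt o)| ≤ (t.len : ℝ) * (B₁ * R ^ i * Φ) :=
      (sum_le_len_mul_weight hK₁ hKK hBR₁ ht (card_mergeIdx_le t) _ (fun o => t.negMergeAt o)
        (fun o => len_negMergeAt_le t o) (fun o => hQ i _ (ht.negMergeAt o))).trans
        (mul_le_mul_of_nonneg_left hlow hL.le)
    have hM2 : |∑ o : MergeIdx t, Q i (t.posMergeAt o)| ≤ (t.len : ℝ) * (B₁ * R ^ i * Φ) :=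
      (sum_le_len_mul_weight hK₁ hKK hBR₁ ht (card_mergeIdx_le t) _ (fun o => t.posMergeAt o)
        (fun o => len_posMergeAt_le t o) (fun o => hQ i _ (ht.posMergeAt o))).trans
        (mul_le_mul_of_nonneg_left hlow hL.le)
    -- ### the three budget inequalities
    have hBRi : 0 ≤ B * R ^ i := mul_nonneg hB0 (pow_nonneg hR0 _)
    have k1 : 2 * (B * R ^ i * ((t.len : ℝ) * X)) ≤ (1 / 4) * ((t.len : ℝ) * (B * R ^ i * Φ)) := by
      rw [← hKX]
      have h2 : (2 : ℝ) ≤ (1 / 4) * K := by linarith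
      calc 2 * (B * R ^ i * ((t.len : ℝ) * X)) = 2 * (B * R ^ i * (t.len : ℝ) * X) := by ring
        _ ≤ ((1 / 4) * K) * (B * R ^ i * (t.len : ℝ) * X) :=
            mul_le_mul_of_nonneg_right h2 (mul_nonneg (mul_nonneg hBRi hL.le) hX0)
        _ = (1 / 4) * ((t.len : ℝ) * (B * R ^ i * (K * X))) := by ring
    have k2 : 2 * (E * ((t.len : ℝ) * (((2 * (d - 1) : ℕ) : ℝ) * (256 * (K ^ 4 * Φ))))) ≤
        (1 / 4) * ((t.len : ℝ) * (B * R ^ i * Φ)) := by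
      calc 2 * (E * ((t.len : ℝ) * (((2 * (d - 1) : ℕ) : ℝ) * (256 * (K ^ 4 * Φ)))))
          = (2 * ((2 * (d - 1) : ℕ) : ℝ) * 256 * K ^ 4 * E) * ((t.len : ℝ) * Φ) := by ring
        _ ≤ (B * R ^ i / 4) * ((t.len : ℝ) * Φ) := mul_le_mul_of_nonneg_right hE (mul_nonneg hL.le hΦ0)
        _ = (1 / 4) * ((t.len : ℝ) * (B * R ^ i * Φ)) := by ring
    have k3 : 5 * ((t.len : ℝ) * (B₁ * R ^ i * Φ)) ≤ (5 / 12) * ((t.len : ℝ) * (B * R ^ i * Φ)) := by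
      have h : 12 * B₁ * R ^ i * Φ ≤ B * R ^ i * Φ :=
        mul_le_mul_of_nonneg_right (mul_le_mul_of_nonneg_right hBB (pow_nonneg hR0 i)) hΦ0
      calc 5 * ((t.len : ℝ) * (B₁ * R ^ i * Φ)) = (5 / 12) * ((t.len : ℝ) * (12 * B₁ * R ^ i * Φ)) := by ring
        _ ≤ (5 / 12) * ((t.len : ℝ) * (B * R ^ i * Φ)) :=
            mul_le_mul_of_nonneg_left (mul_le_mul_of_nonneg_left h hL.le) (by norm_num)
    have hT0 : 0 ≤ (t.len : ℝ) * (B * R ^ i * Φ) := mul_nonneg hL.le (mul_nonneg hBRi hΦ0)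
    -- ### assemble
    have e := hrec t hne hgood
    obtain ⟨a1, b1⟩ := abs_le.mp hS1
    obtain ⟨a2, b2⟩ := abs_le.mp hS2
    obtain ⟨a3, b3⟩ := abs_le.mp hD1
    obtain ⟨a4, b4⟩ := abs_le.mp hD2
    obtain ⟨a5, b5⟩ := abs_le.mp hPt
    obtain ⟨a6, b6⟩ := abs_le.mp hT1
    obtain ⟨a7, b7⟩ := abs_le.mp hT2
    obtain ⟨a8, b8⟩ := abs_le.mp hM1
    obtain ⟨a9, b9⟩ := abs_le.mp hM2
    have hup : (t.len : ℝ) * c i t ≤ (t.len : ℝ) * (B * R ^ i * Φ) := by linarith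
    have hlo : (t.len : ℝ) * (-(B * R ^ i * Φ)) ≤ (t.len : ℝ) * c i t := by linarith
    exact abs_le.mpr ⟨le_of_mul_le_mul_left hlo hL, le_of_mul_le_mul_left hup hL⟩
  -- ### induction on the `β`-degree
  intro i
  induction i with
  | zero =>
    refine inner 0 (fun _ => 0) 0 le_rfl (fun t _ => by
      rw [abs_zero]; exact mul_nonneg le_rfl (mul_nonneg (pow_nonneg hK0 _) (catProd_nonneg t)) |>.trans_eq
        (by ring)) (by rw [mul_zero]; positivity) fun s hne hgood => ?_
    simpa only [Finset.sum_const_zero, add_zero, sub_zero] using hrec0 s hne hgood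
  | succ i ih =>
    refine inner (i + 1) (c i) (B * R ^ i) (mul_nonneg hB0 (pow_nonneg hR0 _)) ih ?_ (hrecS i)
    have h := mul_le_mul_of_nonneg_right hAR (mul_nonneg hB0 (pow_nonneg hR0 i))
    calc 2 * ((2 * (d - 1) : ℕ) : ℝ) * 256 * K ^ 4 * (B * R ^ i) ≤ R / 4 * (B * R ^ i) := h
      _ = B * R ^ (i + 1) / 4 := by rw [pow_succ]; ring

/-! ## All levels -/

/-- **The Catalan bound for the whole coefficient family** (the lane's form of Chatterjee–Jafarov's Lemma 7.3): for the
family `b` of `seriesCoeff_exists` there are constants `K_j ≥ 1`, `R_j > 0`, `B_j ≥ 1`, all non-decreasing in the level `j`,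
with `|b_{j,i}(s)| ≤ B_j R_jⁱ K_j^{ι(s)} Π_r C_{|l_r|−1}` for every genuine loop sequence `s`.  (Explicitly `K_0 = 8`,
`K_{j+1} = 64K_j²`, `R_j = 4A_dK_j⁴ + 1`, `B_j = 12^j`.)
[cite: ChatterjeeJafarov2016OneOverN, Lemma 7.3; Chatterjee2019LargeN, Lemma 10.1] -/
theorem seriesCoeff_bound {b : ℕ → ℕ → LoopSeq d → ℝ}
    (h0 : ∀ (i : ℕ) (u : LoopSeq d), b 0 i u = 0) (h1 : ∀ (i : ℕ) (u : LoopSeq d), b 1 i u = 0)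
    (hnil : ∀ k i, b (k + 2) i [] = if k = 0 ∧ i = 0 then 1 else 0)
    (hrec0 : ∀ (k : ℕ) (s : LoopSeq d), s ≠ [] → (∀ l ∈ s, l ≠ []) →
      (s.len : ℝ) * b (k + 2) 0 s -
          ((∑ o : InvIdx s, b (k + 2) 0 (s.negSplitAt o)) - (∑ o : SameIdx s, b (k + 2) 0 (s.posSplitAt o))) =
        (s.len : ℝ) * b (k + 1) 0 s
          + ((∑ o : SameIdx s, b (k + 1) 0 (s.negTwistAt o)) - ∑ o : InvIdx s, b (k + 1) 0 (s.posTwistAt o))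
          + ((∑ o : MergeIdx s, b k 0 (s.negMergeAt o)) - ∑ o : MergeIdx s, b k 0 (s.posMergeAt o)))
    (hrecS : ∀ (k i : ℕ) (s : LoopSeq d), s ≠ [] → (∀ l ∈ s, l ≠ []) →
      (s.len : ℝ) * b (k + 2) (i + 1) s -
          ((∑ o : InvIdx s, b (k + 2) (i + 1) (s.negSplitAt o)) - (∑ o : SameIdx s, b (k + 2) (i + 1) (s.posSplitAt o))
            + (∑ o : DeformIdx s, b (k + 2) i (s.negDeformAt o)) - (∑ o : DeformIdx s, b (k + 2) i (s.posDeformAt o))) =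
        (s.len : ℝ) * b (k + 1) (i + 1) s
          + ((∑ o : SameIdx s, b (k + 1) (i + 1) (s.negTwistAt o)) - ∑ o : InvIdx s, b (k + 1) (i + 1) (s.posTwistAt o))
          + ((∑ o : MergeIdx s, b k (i + 1) (s.negMergeAt o)) - ∑ o : MergeIdx s, b k (i + 1) (s.posMergeAt o))) :
    ∃ K R B : ℕ → ℝ, (∀ j, 1 ≤ K j) ∧ (∀ j, K j ≤ K (j + 1)) ∧ (∀ j, 0 < R j) ∧ (∀ j, R j ≤ R (j + 1)) ∧
      (∀ j, 1 ≤ B j) ∧ (∀ j, B j ≤ B (j + 1)) ∧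
      ∀ (j i : ℕ) (s : LoopSeq d), IsLoopSeq s → |b j i s| ≤ B j * R j ^ i * (K j ^ s.index * catProd s) := by
  -- constants
  obtain ⟨K, hK0, hKs⟩ : ∃ K : ℕ → ℝ, K 0 = 8 ∧ ∀ j, K (j + 1) = 64 * K j ^ 2 :=
    ⟨fun j => Nat.rec (8 : ℝ) (fun _ x => 64 * x ^ 2) j, rfl, fun _ => rfl⟩
  have hK8 : ∀ j, 8 ≤ K j := by
    intro j
    induction j with
    | zero => rw [hK0]
    | succ j ih => rw [hKs]; nlinarith
  have hK1 : ∀ j, 1 ≤ K j := fun j => by linarith [hK8 j]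
  have hKmono : ∀ j, K j ≤ K (j + 1) := fun j => by rw [hKs]; nlinarith [hK8 j]
  have hKK : ∀ j, 64 * K j ^ 2 ≤ K (j + 1) := fun j => (hKs j).ge
  set A : ℝ := 2 * ((2 * (d - 1) : ℕ) : ℝ) * 256 with hA
  have hA0 : 0 ≤ A := by rw [hA]; positivity
  set R : ℕ → ℝ := fun j => 4 * A * K j ^ 4 + 1 with hR
  have hR1 : ∀ j, 1 ≤ R j := fun j => by
    have := hK1 j; simp only [hR]; nlinarith [pow_nonneg (zero_le_one.trans (hK1 j)) 4]
  have hRpos : ∀ j, 0 < R j := fun j => by linarith [hR1 j]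
  have hRmono : ∀ j, R j ≤ R (j + 1) := fun j => by
    simp only [hR]
    have := pow_le_pow_left₀ (zero_le_one.trans (hK1 j)) (hKmono j) 4
    nlinarith
  have hAR : ∀ j, A * K j ^ 4 ≤ R j / 4 := fun j => by simp only [hR]; linarith
  set B : ℕ → ℝ := fun j => (12 : ℝ) ^ j with hB
  have hB1 : ∀ j, 1 ≤ B j := fun j => one_le_pow₀ (by norm_num)
  have hBmono : ∀ j, B j ≤ B (j + 1) := fun j => by simp only [hB, pow_succ]; nlinarith [hB1 j]
  have hBs : ∀ j, 12 * B j ≤ B (j + 1) := fun j => by simp only [hB, pow_succ]; linarith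
  refine ⟨K, R, B, hK1, hKmono, hRpos, hRmono, hB1, hBmono, ?_⟩
  -- two-step induction on the level
  intro j
  induction j using Nat.strong_induction_on with
  | _ j ihj =>
  rcases j with _ | _ | k
  · intro i s _
    rw [h0, abs_zero]
    exact mul_nonneg (mul_nonneg (zero_le_one.trans (hB1 0)) (pow_nonneg (hRpos 0).le _))
      (mul_nonneg (pow_nonneg (zero_le_one.trans (hK1 0)) _) (catProd_nonneg s))
  · intro i s _
    rw [h1, abs_zero]
    exact mul_nonneg (mul_nonneg (zero_le_one.trans (hB1 1)) (pow_nonneg (hRpos 1).le _))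
      (mul_nonneg (pow_nonneg (zero_le_one.trans (hK1 1)) _) (catProd_nonneg s))
  -- level `k + 2` from levels `k + 1` and `k`, both weakened to the constants of level `k + 1`
  have hP := ihj (k + 1) (by omega)
  have hQ : ∀ (i : ℕ) (t : LoopSeq d), IsLoopSeq t →
      |b k i t| ≤ B (k + 1) * R (k + 1) ^ i * (K (k + 1) ^ t.index * catProd t) := by
    intro i t ht
    refine (ihj k (by omega) i t ht).trans ?_
    exact mul_le_mul (mul_le_mul (hBmono k) (pow_le_pow_left₀ (hRpos k).le (hRmono k) i) (pow_nonneg (hRpos k).le _)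
      (zero_le_one.trans (hB1 _))) (weight_mono (zero_le_one.trans (hK1 k)) (hKmono k) t)
      (mul_nonneg (pow_nonneg (zero_le_one.trans (hK1 k)) _) (catProd_nonneg t))
      (mul_nonneg (zero_le_one.trans (hB1 _)) (pow_nonneg (hRpos _).le _))
  refine seriesCoeff_level_bound (hK1 (k + 1)) (hKK (k + 1)) (hK8 (k + 2)) (hRpos (k + 1)).le (hRmono (k + 1))
    (hR1 (k + 2)) (hAR (k + 2)) (zero_le_one.trans (hB1 (k + 1))) (hBs (k + 1)) (hB1 (k + 2))
    (b (k + 2)) (b (k + 1)) (b k) hP hQ (fun i => ?_) (hrec0 k) (hrecS k)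
  rw [hnil]
  split_ifs <;> simp

end StringDuality

end Summit.QuantumFields.GaugeBoot

end
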